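import Summits.BirchSwinnertonDyer.BirchSwinnertonDyer.Theorems.ManinLocalTwoThreeManinPrimeToAdditiveFiveLeOfPrintAndItems
import Summits.BirchSwinnertonDyer.BirchSwinnertonDyer.Theorems.EdixhovenFibreFiveSevenStarredOptimalManinUnitFiveSevenTameTwistLever
import Literature.NumberTheory.EllipticCurves.ManinConstantQuadraticTwistIstarProofs
import HarnessLib

/-!
# Route `ManinLocalTwoThree`, residual crux C5 `ManinPrimeToAdditiveFiveLe`
# (stmt-BirchSwinnertonDyer-22969), line `upper_anchor`: **the two reducible cores RED(57), RED(11)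
# SHARPENED by facts the line ledger already carries — Cremona ≤ 5·10⁵, ČNS Thm. 1.2, and the four
# printed semistable facts (every `Iₙ*` fibre is closed)**

Piece ε of the width seat (HOME STATUS 2026-08-28, after allocation ζ = p611587). The line ledger
`maninPrimeToAdditiveFiveLe_of_kato57_print_of_kp57_of_reducibleCores` (p611587) reads
C5 ⟸ {F″, ČNS, Cremona, EdK, EdG} ∧ KP57 ∧ RED(57) ∧ RED(11), where the two OPEN cores are, on globally
twist-minimal classes with a conductor-level lattice-optimal datum `D` and `p² ∣ N(W)`, `E[p]` reducible:
RED(57) at `p ∈ {5,7}` (no further clause) and RED(11) at `p > 7` with `ord_p Δ_min ≤ 4`, the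
(G)-ordinary `∃`-clause and `p ∣ deg φ`. Three of the ledger's OWN hypotheses cut both cores for free,
with no irreducibility needed anywhere:

* Cremona's table (`cremona_abs_maninConstant_eq_one_of_level_le_500000`): `|c(D)| = 1` whenever
  `N(W) ≤ 5·10⁵` — so both cores may assume `500000 < N(W)`;
* ČNS Thm. 1.2 (`cesnaviciusNeururerSaha_padicVal_maninConstant_le_modularDegree`, through the tree's
  `not_dvd_maninConstant_of_not_dvd_modularDegree`, valid at every `p ≥ 5`): `p ∤ deg φ ⟹ p ∤ c` — so
  RED(57) may assume `p ∣ deg φ` (RED(11) already does);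
* the four PRINTED semistable-prime facts that RED(57)/RED(11) carry as leading binders (Mazur 1978
  Cor. 4.1, Abbes–Ullmo 1996 Thm. A, Česnavičius 2018 Thm. 1.2, modularity) close EVERY Kodaira-`Iₙ*`
  fibre at an odd prime (`Literature…not_dvd_maninConstant_of_kodairaSymbolAt_eq_Istar`: `I₀*` resp.
  `Iₙ*`, `n ≥ 1`, is the `χ_{p*}`-twist of a curve good resp. multiplicative at `p`, and the twist road
  transports `p ∤ c`) — so RED(57) may assume the fibre at `p` is NOT `Iₙ*`, i.e. (Tate's algorithm at
  an additive `p ≥ 5`, tree `kodairaSymbolAt_placeOf_cases_of_addv`) of type II, III, IV, IV*, III* or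
  II* (`e ∈ {3,4,6}`). For RED(11) this is already implied by `ord_p Δ_min ≤ 4`.

So: §1 `coreRED57_of_cns_cremona_of_coreRED57sharp` (RED(57) ⟸ ČNS ∧ Cremona ∧ RED(57)♯) and
`coreRED11_of_cremona_of_coreRED11sharp` (RED(11) ⟸ Cremona ∧ RED(11)♯); §2 the line ledger on the
sharpened cores, `maninPrimeToAdditiveFiveLe_of_kato57_print_of_kp57_of_sharpCores`:
**C5 BY NAME ⟸ {F″, ČNS 1.2, Cremona ≤ 5·10⁵, Edixhoven Thm. 3 ×2} ∧ KP57 ∧ RED(57)♯ ∧ RED(11)♯** —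
the SAME seven named inputs as p611587, with both open cores now disjoint from Cremona's range by
their own statement (RED(57)♯: `p ∈ {5,7}`, rational `p`-isogeny, `p² ∣ N > 5·10⁵`, twist-minimal,
Kodaira II/III/IV/IV*/III*/II* at `p`, `p ∣ deg φ`; RED(11)♯: RED(11) ∧ `N > 5·10⁵`).

HONEST STATUS: conditional-result (`--supports … --as helper`); closes nothing; the sharpened cores are
OPEN mathematics beyond the tables (no lever in the tree or in print at `p ∈ {5,7}` on the reducible
locus: Kato/K★ need `E[p]` irreducible, Edixhoven Thm. 3 needs `p > 7`, ČNS needs `p ∤ deg φ`).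
Nothing here proves BSD, Manin's conjecture or C5. Seat bsd-line-ml23-c5-p1-w2 (width prover, gen 2).

References: [Cremona2022ManinConstants]; [CesnaviciusNeururerSaha2023] Thm. 1.2, §1 p. 2;
[EdixhovenManin1991] §1, Thm. 3; [Mazur1978] Cor. 4.1; [AbbesUllmo1996] Thm. A; [Cesnavicius2018]
Thm. 1.2; [Stevens1989] (5.2), (5.4); [SilvermanATAEC1994] IV Table 4.1.
-/

set_option autoImplicit false
-- the Theorems namespace of this sub repeats the summit name by design (D-0017 nested layout)
set_option linter.dupNamespace false

noncomputable section

open scoped Classical NumberField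

namespace Summit.BirchSwinnertonDyer.BirchSwinnertonDyer.Theorems

open WeierstrassCurve IsDedekindDomain NumberField
  Literature.NumberTheory.EllipticCurves Literature.NumberTheory.EllipticCurves.ModularForms
  Literature.NumberTheory.EllipticCurves.Rank1Residual
  Summit.BirchSwinnertonDyer.Rank1Residual.ManinAdditive
  Summit.BirchSwinnertonDyer.Rank1Residual.Additive
  Summit.BirchSwinnertonDyer.BirchSwinnertonDyer.Theses.EdixhovenFibreFiveSeven
  Summit.BirchSwinnertonDyer.BirchSwinnertonDyer.Cruxes.StarredOptimalManinUnitFiveSeven.KatoLever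

/-! ## §1 The two reducible cores, sharpened -/

/-- **Cremona's cut, pointwise.** A lattice-optimal datum `D` (`Λ_W ⊆ c·Λ_f`) of a globally minimal `W`
at a level `N ≤ 5·10⁵` has `p ∤ c(D)` for every prime `p`, GRANTED Cremona's table (`|c| = 1`).
[cite: CesnaviciusNeururerSaha2023, §1 p. 2] -/
theorem not_dvd_maninConstant_of_level_le_500000
    (h500k : cremona_abs_maninConstant_eq_one_of_level_le_500000)
    (W : WeierstrassCurve ℚ) [W.IsElliptic] [W.IsGloballyMinimal] {N : ℕ} [NeZero N]
    (D : ModularParametrizationData W N)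
    (hopt : ∀ z ∈ D.L.lattice, ∃ w ∈ periodLattice D.f, z = D.c * w) (hN : N ≤ 500000)
    {p : ℕ} (hp : p.Prime) : ¬ (p : ℤ) ∣ D.maninConstant := by
  have h1 : |D.maninConstant| = 1 := h500k W D hopt hN
  intro hdvd
  have h1' : (p : ℤ) ∣ 1 := by
    rw [← h1]
    exact (dvd_abs _ _).mpr hdvd
  have h := Int.eq_one_of_dvd_one (by positivity) h1'
  have hp1 : p = 1 := by exact_mod_cast h
  exact hp.one_lt.ne' hp1

/-- **RED(57) ⟸ ČNS ∧ Cremona ∧ RED(57)♯.** The open core RED(57) of the line ledger (p608852 /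
p611587: `p ∈ {5,7}`, `E[p]` reducible, `p² ∣ N(W)`, globally twist-minimal, conductor-level
lattice-optimal datum ⟹ `p ∤ c`) follows from the cite-only facts ČNS Thm. 1.2 (`hCNS`) and Cremona
≤ 5·10⁵ (`h500k`) and its SHARPENED form RED(57)♯ (`h57s`): the same binders plus `500000 < N(W)`,
`p ∣ deg φ` and «no `Iₙ*` fibre at `p`» — the last discharged by the four printed semistable facts
that RED(57) itself carries (`not_dvd_maninConstant_of_kodairaSymbolAt_eq_Istar`). CONDITIONAL; the
sharpened core is open. [cite: CesnaviciusNeururerSaha2023, Thm. 1.2 and §1 p. 2]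
[cite: EdixhovenManin1991, §1] [cite: Stevens1989, Lemmas (5.2), (5.4)]
[cite: SilvermanATAEC1994, IV Table 4.1] -/
theorem coreRED57_of_cns_cremona_of_coreRED57sharp
    (hCNS : cesnaviciusNeururerSaha_padicVal_maninConstant_le_modularDegree)
    (h500k : cremona_abs_maninConstant_eq_one_of_level_le_500000)
    (h57s : mazur_not_dvd_maninConstant_of_odd → abbesUllmo_not_dvd_maninConstant_of_not_dvd_level →
      cesnavicius_not_two_dvd_maninConstant_of_two_dvd_level → exists_isNewformOf →
      ∀ (W : WeierstrassCurve ℚ) [W.IsElliptic] [W.IsGloballyMinimal] [NeZero (W.conductorNorm ℤ)]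
        (D : ModularParametrizationData W (W.conductorNorm ℤ)),
        IsLatticeOptimal D → ∀ (p : ℕ) (hp : p.Prime), (p = 5 ∨ p = 7) → p ^ 2 ∣ W.conductorNorm ℤ →
        ¬ (∃ (W' : WeierstrassCurve ℚ) (q : ℕ), W'.IsElliptic ∧ W'.IsGloballyMinimal ∧ q.Prime ∧
            q ≠ 2 ∧ q ^ 2 ∣ W.conductorNorm ℤ ∧
            IsIsogenous W (W'.quadraticTwist (((-1 : ℤ) ^ (q / 2) * q : ℤ) : ℚ)) ∧
            ¬ q ^ 2 ∣ W'.conductorNorm ℤ) →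
        ¬ (∃ (W' : WeierstrassCurve ℚ) (d : ℤ), W'.IsElliptic ∧ W'.IsGloballyMinimal ∧
            (d = -1 ∨ d = 2 ∨ d = -2) ∧ 2 ^ 2 ∣ W.conductorNorm ℤ ∧
            IsIsogenous W (W'.quadraticTwist (d : ℚ)) ∧ ¬ 2 ^ 2 ∣ W'.conductorNorm ℤ) →
        ¬ W.HasIrreducibleModPGaloisRep p →
        500000 < W.conductorNorm ℤ →
        p ∣ D.modularDegree →
        (∀ n : ℕ, W.kodairaSymbolAt ((Rat.HeightOneSpectrum.primesEquiv (R := ℤ)).symm ⟨p, hp⟩) ≠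
          .Istar n) →
        ¬ (p : ℤ) ∣ D.maninConstant) :
    mazur_not_dvd_maninConstant_of_odd → abbesUllmo_not_dvd_maninConstant_of_not_dvd_level →
    cesnavicius_not_two_dvd_maninConstant_of_two_dvd_level → exists_isNewformOf →
    ∀ (W : WeierstrassCurve ℚ) [W.IsElliptic] [W.IsGloballyMinimal] [NeZero (W.conductorNorm ℤ)]
      (D : ModularParametrizationData W (W.conductorNorm ℤ)),
      IsLatticeOptimal D → ∀ p : ℕ, p.Prime → (p = 5 ∨ p = 7) → p ^ 2 ∣ W.conductorNorm ℤ →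
      ¬ (∃ (W' : WeierstrassCurve ℚ) (q : ℕ), W'.IsElliptic ∧ W'.IsGloballyMinimal ∧ q.Prime ∧
          q ≠ 2 ∧ q ^ 2 ∣ W.conductorNorm ℤ ∧
          IsIsogenous W (W'.quadraticTwist (((-1 : ℤ) ^ (q / 2) * q : ℤ) : ℚ)) ∧
          ¬ q ^ 2 ∣ W'.conductorNorm ℤ) →
      ¬ (∃ (W' : WeierstrassCurve ℚ) (d : ℤ), W'.IsElliptic ∧ W'.IsGloballyMinimal ∧
          (d = -1 ∨ d = 2 ∨ d = -2) ∧ 2 ^ 2 ∣ W.conductorNorm ℤ ∧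
          IsIsogenous W (W'.quadraticTwist (d : ℚ)) ∧ ¬ 2 ^ 2 ∣ W'.conductorNorm ℤ) →
      ¬ W.HasIrreducibleModPGaloisRep p →
      ¬ (p : ℤ) ∣ D.maninConstant := by
  intro hM hAU hC hnf W _ _ _ D hD p hp h57 hpN hodd hdy hred
  have h5 : 5 ≤ p := by rcases h57 with rfl | rfl <;> norm_num
  have hp2 : p ≠ 2 := by omega
  have hopt : ∀ z ∈ D.L.lattice, ∃ w ∈ periodLattice D.f, z = D.c * w := hD
  -- Cremona's range
  by_cases hN : W.conductorNorm ℤ ≤ 500000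
  · exact not_dvd_maninConstant_of_level_le_500000 h500k W D hopt hN hp
  · push Not at hN
    -- the ČNS degree slice
    by_cases hdeg : p ∣ D.modularDegree
    · -- every `Iₙ*` fibre is closed by the four printed semistable facts (twist road)
      by_cases hI : ∃ n : ℕ,
          W.kodairaSymbolAt ((Rat.HeightOneSpectrum.primesEquiv (R := ℤ)).symm ⟨p, hp⟩) = .Istar n
      · obtain ⟨n, hn⟩ := hI
        exact not_dvd_maninConstant_of_kodairaSymbolAt_eq_Istar hM hAU hC hnf D hopt hp hp2 hn
      · push Not at hI
        exact h57s hM hAU hC hnf W D hD p hp h57 hpN hodd hdy hred hN hdeg hI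
    · exact not_dvd_maninConstant_of_not_dvd_modularDegree hCNS W D hp h5 hdeg

/-- **RED(11) ⟸ Cremona ∧ RED(11)♯.** The open core RED(11) of the line ledger (p608852 / p611587:
`p > 7`, `E[p]` reducible, `p² ∣ N(W)`, globally twist-minimal, conductor-level lattice-optimal datum,
`ord_p Δ_min ≤ 4`, the (G)-ordinary `∃`-clause, `p ∣ deg φ` ⟹ `p ∤ c`) follows from Cremona ≤ 5·10⁵
(`h500k`) and RED(11)♯ (`h11s`) = the same binders plus `500000 < N(W)`. CONDITIONAL; the sharpened
core is open. [cite: CesnaviciusNeururerSaha2023, §1 p. 2] -/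
theorem coreRED11_of_cremona_of_coreRED11sharp
    (h500k : cremona_abs_maninConstant_eq_one_of_level_le_500000)
    (h11s : mazur_not_dvd_maninConstant_of_odd → abbesUllmo_not_dvd_maninConstant_of_not_dvd_level →
      cesnavicius_not_two_dvd_maninConstant_of_two_dvd_level → exists_isNewformOf →
      ∀ (W : WeierstrassCurve ℚ) [W.IsElliptic] [W.IsGloballyMinimal] [NeZero (W.conductorNorm ℤ)]
        (D : ModularParametrizationData W (W.conductorNorm ℤ)),
        IsLatticeOptimal D → ∀ p : ℕ, p.Prime → 7 < p → p ^ 2 ∣ W.conductorNorm ℤ →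
        ¬ (∃ (W' : WeierstrassCurve ℚ) (q : ℕ), W'.IsElliptic ∧ W'.IsGloballyMinimal ∧ q.Prime ∧
            q ≠ 2 ∧ q ^ 2 ∣ W.conductorNorm ℤ ∧
            IsIsogenous W (W'.quadraticTwist (((-1 : ℤ) ^ (q / 2) * q : ℤ) : ℚ)) ∧
            ¬ q ^ 2 ∣ W'.conductorNorm ℤ) →
        ¬ (∃ (W' : WeierstrassCurve ℚ) (d : ℤ), W'.IsElliptic ∧ W'.IsGloballyMinimal ∧
            (d = -1 ∨ d = 2 ∨ d = -2) ∧ 2 ^ 2 ∣ W.conductorNorm ℤ ∧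
            IsIsogenous W (W'.quadraticTwist (d : ℚ)) ∧ ¬ 2 ^ 2 ∣ W'.conductorNorm ℤ) →
        ¬ W.HasIrreducibleModPGaloisRep p →
        padicValInt p W.minimalDiscriminantInt ≤ 4 →
        (∃ (L : Type) (_ : Field L) (_ : NumberField L) (_ : IsCyclotomicExtension {p} ℚ L)
            (F : IntermediateField ℚ L),
            ∀ w : HeightOneSpectrum (𝓞 F), (p : 𝓞 F) ∈ w.asIdeal →
              (W.baseChange F).HasGoodReductionAt w ∧ (W.baseChange F).HasUnitRootAt w) →
        p ∣ D.modularDegree →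
        500000 < W.conductorNorm ℤ →
        ¬ (p : ℤ) ∣ D.maninConstant) :
    mazur_not_dvd_maninConstant_of_odd → abbesUllmo_not_dvd_maninConstant_of_not_dvd_level →
    cesnavicius_not_two_dvd_maninConstant_of_two_dvd_level → exists_isNewformOf →
    ∀ (W : WeierstrassCurve ℚ) [W.IsElliptic] [W.IsGloballyMinimal] [NeZero (W.conductorNorm ℤ)]
      (D : ModularParametrizationData W (W.conductorNorm ℤ)),
      IsLatticeOptimal D → ∀ p : ℕ, p.Prime → 7 < p → p ^ 2 ∣ W.conductorNorm ℤ →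
      ¬ (∃ (W' : WeierstrassCurve ℚ) (q : ℕ), W'.IsElliptic ∧ W'.IsGloballyMinimal ∧ q.Prime ∧
          q ≠ 2 ∧ q ^ 2 ∣ W.conductorNorm ℤ ∧
          IsIsogenous W (W'.quadraticTwist (((-1 : ℤ) ^ (q / 2) * q : ℤ) : ℚ)) ∧
          ¬ q ^ 2 ∣ W'.conductorNorm ℤ) →
      ¬ (∃ (W' : WeierstrassCurve ℚ) (d : ℤ), W'.IsElliptic ∧ W'.IsGloballyMinimal ∧
          (d = -1 ∨ d = 2 ∨ d = -2) ∧ 2 ^ 2 ∣ W.conductorNorm ℤ ∧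
          IsIsogenous W (W'.quadraticTwist (d : ℚ)) ∧ ¬ 2 ^ 2 ∣ W'.conductorNorm ℤ) →
      ¬ W.HasIrreducibleModPGaloisRep p →
      padicValInt p W.minimalDiscriminantInt ≤ 4 →
      (∃ (L : Type) (_ : Field L) (_ : NumberField L) (_ : IsCyclotomicExtension {p} ℚ L)
          (F : IntermediateField ℚ L),
          ∀ w : HeightOneSpectrum (𝓞 F), (p : 𝓞 F) ∈ w.asIdeal →
            (W.baseChange F).HasGoodReductionAt w ∧ (W.baseChange F).HasUnitRootAt w) →
      p ∣ D.modularDegree →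
      ¬ (p : ℤ) ∣ D.maninConstant := by
  intro hM hAU hC hnf W _ _ _ D hD p hp h7 hpN hodd hdy hred hlow hGo hdeg
  have hopt : ∀ z ∈ D.L.lattice, ∃ w ∈ periodLattice D.f, z = D.c * w := hD
  by_cases hN : W.conductorNorm ℤ ≤ 500000
  · exact not_dvd_maninConstant_of_level_le_500000 h500k W D hopt hN hp
  · push Not at hN
    exact h11s hM hAU hC hnf W D hD p hp h7 hpN hodd hdy hred hlow hGo hdeg hN

/-! ## §2 The line ledger on the sharpened cores -/

/-- **C5 `ManinPrimeToAdditiveFiveLe` BY NAME ⟸ five printed facts + KP57 + two SHARPENED open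
cores** (line `upper_anchor`'s ledger; conditional-result, C5 is NOT proved): Kato F″ (`hK57`), ČNS
Thm. 1.2 (`hCNS`), Cremona ≤ 5·10⁵ (`h500k`), Edixhoven Thm. 3 Kodaira half (`hEdK`) and ordinarity
half (`hEdG`); the registered crux KP57 BY NAME (`hKP57`); cores RED(57)♯ (`h57s`: `p ∈ {5,7}`, `E[p]`
reducible, `p² ∣ N > 5·10⁵`, twist-minimal, no `Iₙ*` fibre at `p`, `p ∣ deg φ`) and RED(11)♯ (`h11s`:
RED(11) ∧ `N > 5·10⁵`). The SAME seven named inputs as p611587; both open cores now lie beyond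
Cremona's range by their own statement. Proof: p610200 ∘ §1, with F′ := `kato_neron_of_five_le hK57` as in p611587.
[cite: Kato2004Asterisque, (8.1.3) (p. 180), Thm. 9.7 (p. 189)] [cite: KimNakamura2020, Cor. 2.4]
[cite: KostersPannekoek2017, Thm. 1 and Cor. 2] [cite: EdixhovenManin1991, Thm. 3]
[cite: CesnaviciusNeururerSaha2023, Thm. 1.2 and §1 p. 2] -/
theorem maninPrimeToAdditiveFiveLe_of_kato57_print_of_kp57_of_sharpCores
    (hK57 : kato_neron_isIntegral_twistedSymbolSum_of_additive_five_le)
    (hCNS : cesnaviciusNeururerSaha_padicVal_maninConstant_le_modularDegree)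
    (h500k : cremona_abs_maninConstant_eq_one_of_level_le_500000)
    (hEdK : edixhoven_not_dvd_maninConstant_of_kodairaSymbol_ne)
    (hEdG : edixhoven_not_dvd_maninConstant_of_not_potentiallyGoodOrdinary)
    (hKP57 : KPResidueManinUnitFiveSeven)
    (h57s : mazur_not_dvd_maninConstant_of_odd → abbesUllmo_not_dvd_maninConstant_of_not_dvd_level →
      cesnavicius_not_two_dvd_maninConstant_of_two_dvd_level → exists_isNewformOf →
      ∀ (W : WeierstrassCurve ℚ) [W.IsElliptic] [W.IsGloballyMinimal] [NeZero (W.conductorNorm ℤ)]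
        (D : ModularParametrizationData W (W.conductorNorm ℤ)),
        IsLatticeOptimal D → ∀ (p : ℕ) (hp : p.Prime), (p = 5 ∨ p = 7) → p ^ 2 ∣ W.conductorNorm ℤ →
        ¬ (∃ (W' : WeierstrassCurve ℚ) (q : ℕ), W'.IsElliptic ∧ W'.IsGloballyMinimal ∧ q.Prime ∧
            q ≠ 2 ∧ q ^ 2 ∣ W.conductorNorm ℤ ∧
            IsIsogenous W (W'.quadraticTwist (((-1 : ℤ) ^ (q / 2) * q : ℤ) : ℚ)) ∧
            ¬ q ^ 2 ∣ W'.conductorNorm ℤ) →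
        ¬ (∃ (W' : WeierstrassCurve ℚ) (d : ℤ), W'.IsElliptic ∧ W'.IsGloballyMinimal ∧
            (d = -1 ∨ d = 2 ∨ d = -2) ∧ 2 ^ 2 ∣ W.conductorNorm ℤ ∧
            IsIsogenous W (W'.quadraticTwist (d : ℚ)) ∧ ¬ 2 ^ 2 ∣ W'.conductorNorm ℤ) →
        ¬ W.HasIrreducibleModPGaloisRep p →
        500000 < W.conductorNorm ℤ →
        p ∣ D.modularDegree →
        (∀ n : ℕ, W.kodairaSymbolAt ((Rat.HeightOneSpectrum.primesEquiv (R := ℤ)).symm ⟨p, hp⟩) ≠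
          .Istar n) →
        ¬ (p : ℤ) ∣ D.maninConstant)
    (h11s : mazur_not_dvd_maninConstant_of_odd → abbesUllmo_not_dvd_maninConstant_of_not_dvd_level →
      cesnavicius_not_two_dvd_maninConstant_of_two_dvd_level → exists_isNewformOf →
      ∀ (W : WeierstrassCurve ℚ) [W.IsElliptic] [W.IsGloballyMinimal] [NeZero (W.conductorNorm ℤ)]
        (D : ModularParametrizationData W (W.conductorNorm ℤ)),
        IsLatticeOptimal D → ∀ p : ℕ, p.Prime → 7 < p → p ^ 2 ∣ W.conductorNorm ℤ →
        ¬ (∃ (W' : WeierstrassCurve ℚ) (q : ℕ), W'.IsElliptic ∧ W'.IsGloballyMinimal ∧ q.Prime ∧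
            q ≠ 2 ∧ q ^ 2 ∣ W.conductorNorm ℤ ∧
            IsIsogenous W (W'.quadraticTwist (((-1 : ℤ) ^ (q / 2) * q : ℤ) : ℚ)) ∧
            ¬ q ^ 2 ∣ W'.conductorNorm ℤ) →
        ¬ (∃ (W' : WeierstrassCurve ℚ) (d : ℤ), W'.IsElliptic ∧ W'.IsGloballyMinimal ∧
            (d = -1 ∨ d = 2 ∨ d = -2) ∧ 2 ^ 2 ∣ W.conductorNorm ℤ ∧
            IsIsogenous W (W'.quadraticTwist (d : ℚ)) ∧ ¬ 2 ^ 2 ∣ W'.conductorNorm ℤ) →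
        ¬ W.HasIrreducibleModPGaloisRep p →
        padicValInt p W.minimalDiscriminantInt ≤ 4 →
        (∃ (L : Type) (_ : Field L) (_ : NumberField L) (_ : IsCyclotomicExtension {p} ℚ L)
            (F : IntermediateField ℚ L),
            ∀ w : HeightOneSpectrum (𝓞 F), (p : 𝓞 F) ∈ w.asIdeal →
              (W.baseChange F).HasGoodReductionAt w ∧ (W.baseChange F).HasUnitRootAt w) →
        p ∣ D.modularDegree →
        500000 < W.conductorNorm ℤ →
        ¬ (p : ℤ) ∣ D.maninConstant) :
    Summit.BirchSwinnertonDyer.BirchSwinnertonDyer.Theses.ManinLocalTwoThree.ManinPrimeToAdditiveFiveLe :=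
  maninPrimeToAdditiveFiveLe_of_print_of_kp57_of_reducibleCores (kato_neron_of_five_le hK57) hK57 hCNS
    h500k hKP57 hEdK hEdG (coreRED57_of_cns_cremona_of_coreRED57sharp hCNS h500k h57s)
    (coreRED11_of_cremona_of_coreRED11sharp h500k h11s)

end Summit.BirchSwinnertonDyer.BirchSwinnertonDyer.Theorems

end
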